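import Summits.QuantumFields.BalabanUV.T4Continuum.Support.VariationalPlancherel

/-!
# T⁴ programme, spine node NE2 (U1a), lane P2 — LEAF L0-REG of the variational route, PART 1 (fibre algebra): the
# Euler–Lagrange structure `Ĝ = Δ•Ĥ − (∂̄·Ĥ)∂` of Bałaban's minimiser on the fibre `p = p′ + l` and its energy density
# (`t4/skeletons/NE2-t4-ne2-p2.md` §2; cell `pub-balaban`, row NE2 co-owner #2, lineage t4-ne2-p2 gen 9; part 2 =
# `VariationalRegularity`: the per-fibre inequality and the leaf `MinimiserRegularityL2 d (4d/γ₀)`)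

HONEST FRAMING (T4-DAG p. 1): rung (B)+1 only — NOT infinite volume, NOT a mass gap, NOT Clay.  `U = 1` Fourier algebra on the
torus about Bałaban's (1.63) minimiser; NOT an η-rate by itself; nothing printed is a hypothesis.  PRINTED MODEL (text location
only): [Balaban1984PropagatorsI] pp. 28–29 «Another important property is that the sum over l of the absolute value of this
expression multiplied by |∂_ν(p′+l)||p′+l|^α is bounded by a constant dependent on d only» (SUP-norm Hölder, α < 1; tree
`B5Hk163Holder.weighted_alias_sum_le`); the L² statement with the full power proved here is NOT printed.

MECHANISM ([folklore]; no use of the explicit (1.63) multipliers `h163`).  By the weighted Plancherel of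
`VariationalPlancherel.sum_Delta0_curlHat` the claim is fibrewise; on the fibre `p = p′ + l` the tree's Euler–Lagrange structure
`B5Hk163RDiv.dftV_DstarD_HkOp_of_ne` says `((Δ−∂∂*)H_kB)~(p′+l) = c⁻¹·\overline{u v}(p′+l)·w(p′)` with `w` INDEPENDENT of the alias
`l`, while `(Δ−∂∂*)~ = Δ(p′+l)·Π_{∂(p′+l)^⊥}` gives `½|curl~H|²(p′+l) = |((Δ−∂∂*)H)~|²/Δ(p′+l)`.  Hence the alias-`l` energy density is
`c⁻²|u|²Σ_κ|v_κ|²|w_κ|²/Δ(p′+l)`, the weight `Δ^{fine}(p′+l) = Δ(p′+l)/n²` CANCELS the propagator, and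
`Σ_l |u v_κ|² ≤ Σ_l |u|² = 1` (E4, `sum_Ur_eq_one`) against `Σ_l |u v_κ|²/Δ(p′+l) = φ_κ ≥ γ₀/Δ₀ ≥ γ₀/(4d)` ((1.62) and the printed
lower bound, tree `Delta0_phi162_lower`): weighted ≤ (4d/γ₀)·n⁻²·unweighted, per fibre, uniformly in `n`, the torus and `B`.
-/

noncomputable section

namespace Summit.QuantumFields.BalabanUV.T4Continuum.VariationalRegularityFibre

open scoped Matrix ComplexConjugate BigOperators
open Complex
open Summit.QuantumFields.BalabanUV.T4Continuum.VariationalPlancherel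
open Literature.MathematicalPhysics.QuantumFieldTheory.Balaban1983to89

/-! ## §1 Fibre algebra: the projection `P = Δ·I − ∂∂†` with `∂†∂ = Δ` -/

section algebra

variable {κ : Type*} [Fintype κ]

/-- the Lagrange identity with unit weights: `(Σ|∂_λ|²)(Σ|B_κ|²) − |Σ\bar∂_κB_κ|² = ½Σ_{μ,ν}|∂_μB_ν − ∂_νB_μ|²`
(tree `B5Hk163Form166.lagrange_weighted` at `ω ≡ 1`). [folklore] -/
theorem lagrange_one (dd B : κ → ℂ) :
    (∑ lam, conj (dd lam) * dd lam) * (∑ ka, conj (B ka) * B ka) - (∑ mu, conj (dd mu) * B mu) * (∑ nu, dd nu * conj (B nu))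
      = (1 / 2) * ∑ mu, ∑ nu, conj (dd mu * B nu - dd nu * B mu) * (dd mu * B nu - dd nu * B mu) := by
  have h := B5Hk163Form166.lagrange_weighted (fun _ => (1 : ℂ)) dd B
  simpa using h

/-- for `G := Δ•H − D•∂` with `D = ∂†H`, `Δ = ∂†∂`: `H†G = Δ·H†H − D·D̄`. [folklore] -/
theorem form_proj (dd H : κ → ℂ) :
    star H ⬝ᵥ ((star dd ⬝ᵥ dd) • H - (star dd ⬝ᵥ H) • dd)
      = (star dd ⬝ᵥ dd) * (star H ⬝ᵥ H) - (star dd ⬝ᵥ H) * star (star dd ⬝ᵥ H) := by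
  rw [dotProduct_sub, dotProduct_smul, dotProduct_smul, smul_eq_mul, smul_eq_mul]
  congr 1
  rw [Matrix.star_dotProduct H dd]

/-- … and `G†G = Δ·(Δ·H†H − D·D̄)` (`P² = ΔP`), for `Δ` self-conjugate. [folklore] -/
theorem normSq_proj (dd H : κ → ℂ) (hΔ : star (star dd ⬝ᵥ dd) = star dd ⬝ᵥ dd) :
    star ((star dd ⬝ᵥ dd) • H - (star dd ⬝ᵥ H) • dd) ⬝ᵥ ((star dd ⬝ᵥ dd) • H - (star dd ⬝ᵥ H) • dd)
      = (star dd ⬝ᵥ dd) * ((star dd ⬝ᵥ dd) * (star H ⬝ᵥ H) - (star dd ⬝ᵥ H) * star (star dd ⬝ᵥ H)) := by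
  set Δ := star dd ⬝ᵥ dd with hΔdef
  set D := star dd ⬝ᵥ H with hDdef
  have hHd : star H ⬝ᵥ dd = star D := by rw [hDdef, Matrix.star_dotProduct H dd]
  rw [star_sub, star_smul, star_smul, sub_dotProduct, smul_dotProduct, smul_dotProduct, dotProduct_sub,
    dotProduct_sub, dotProduct_smul, dotProduct_smul, dotProduct_smul, dotProduct_smul]
  simp only [smul_eq_mul]
  rw [hHd, ← hDdef, ← hΔdef, hΔ]
  ring

/-- the star of a `dotProduct` of the form `∂†∂` is itself (it is real). [folklore] -/
theorem star_self_dotProduct (dd : κ → ℂ) : star (star dd ⬝ᵥ dd) = star dd ⬝ᵥ dd :=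
  (Matrix.star_dotProduct dd dd).symm

end algebra

/-! ## §2 The fibre `p = p′ + l` of Bałaban's minimiser: Euler–Lagrange structure and the energy density -/

section fibre

open Literature.MathematicalPhysics.QuantumFieldTheory.Balaban1983to89.B5Prop11Plancherel (Tor fine unitVec sOf dft dftV
  abs_sOf_le sOf_ne_zero)
open Literature.MathematicalPhysics.QuantumFieldTheory.Balaban1983to89.B5Prop11Fiber (dSym d1Sym vSym uSym norm_uSym_sq
  norm_vSym_sq Delta_eq)
open Literature.MathematicalPhysics.QuantumFieldTheory.Balaban1983to89.B5Action121 (Fs GradOp)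
open Literature.MathematicalPhysics.QuantumFieldTheory.Balaban1983to89.B5Block118 (pOf cQ pOf_bijective)
open Literature.MathematicalPhysics.QuantumFieldTheory.Balaban1983to89.B5Hk163Torus (HkOp dft_HkOp)
open Literature.MathematicalPhysics.QuantumFieldTheory.Balaban1983to89.B5Hk163RDiv (DstarD wT dftV_DstarD_HkOp
  dftV_DstarD_HkOp_of_ne dftV_DstarD_HkOp_zero dft_divS_HkOp)
open Literature.MathematicalPhysics.QuantumFieldTheory.Balaban1983to89.B5Hk164Transl (cEnergy)
open Literature.MathematicalPhysics.QuantumFieldTheory.Balaban1983to89.B4Strip (Delta1r S1r DeltaXir shiftr Ur uFactorr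
  Ur_nonneg uFactorr_nonneg)
open Literature.MathematicalPhysics.QuantumFieldTheory.Balaban1983to89.B5Prop11Leaves (uFactorr_le_one sum_Ur_eq_one
  Delta1r_pos Delta1r_le Delta1r_le_DeltaXir_shift)
open Literature.MathematicalPhysics.QuantumFieldTheory.Balaban1983to89.B5Bounds167Lattice (phi162 phi162_eq Delta0_phi162_lower
  curl curlHat hat d1Sq_eq_sum_hat fsym_one)
open Literature.MathematicalPhysics.QuantumFieldTheory.Balaban1983to89.B5Momentum133 (ssym_pOf)
open Literature.MathematicalPhysics.QuantumFieldTheory.Balaban1983to89.T4GaugeActionRate (gam0 gam0_pos)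
open Summit.QuantumFields.BalabanUV.T4Continuum.VariationalLeaves (MinimiserRegularityL2)

variable {d : ℕ} (n : ℕ) [NeZero n] (M : Fin d → ℕ) [hM : ∀ μ, NeZero (M μ)]

/-- the fibre vector `Ĥ(p′+l) ∈ ℂ^d` of the minimiser (components of its DFT at the fine momentum `pOf (k, q)`). [folklore] -/
def Hh (B : Tor M × Fin d → ℂ) (k : Fin d → Fin n) (q : Tor M) : Fin d → ℂ :=
  fun c => (dft (fine n M) *ᵥ B5Action121.comp (fine n M) (HkOp n M *ᵥ B) c) (pOf n M (k, q))

/-- the fibre vector `Ĝ(p′+l) = ((Δ − ∂∂*)H_kB)~(p′+l)`. [folklore] -/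
def Gh (B : Tor M × Fin d → ℂ) (k : Fin d → Fin n) (q : Tor M) : Fin d → ℂ :=
  fun c => (dftV (fine n M) *ᵥ (DstarD n M *ᵥ (HkOp n M *ᵥ B))) (pOf n M (k, q), c)

/-- the fine derivative symbols `∂(p′+l) ∈ ℂ^d`. [cite: Balaban1984PropagatorsI, (1.31) p.23] -/
def dS (k : Fin d → Fin n) (q : Tor M) : Fin d → ℂ := fun c => dSym n k (sOf M q) c

omit [NeZero n] hM in
/-- `∂†∂ = Δ(p′+l)` (tree `B5Prop11Fiber.Delta_eq`). [folklore] -/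
theorem star_dS_dotProduct_dS (k : Fin d → Fin n) (q : Tor M) :
    star (dS n M k q) ⬝ᵥ dS n M k q = ((DeltaXir n 0 (shiftr n k (sOf M q)) : ℝ) : ℂ) := by
  rw [Delta_eq]
  simp only [dotProduct, Pi.star_apply, dS, Complex.star_def, Complex.conj_mul', Complex.ofReal_sum, Complex.ofReal_pow]

/-- the divergence symbol of the minimiser on the fibre: `∂(p′+l)†Ĥ = (∂*H_kB)~(p′+l)` (tree `dft_divS_HkOp`, `dft_HkOp`).
[folklore] -/
theorem star_dS_dotProduct_Hh (B : Tor M × Fin d → ℂ) (k : Fin d → Fin n) (q : Tor M) :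
    star (dS n M k q) ⬝ᵥ Hh n M B k q
      = (dft (fine n M) *ᵥ ((GradOp (fine n M) (n : ℂ))ᴴ *ᵥ (HkOp n M *ᵥ B))) (pOf n M (k, q)) := by
  rw [dft_divS_HkOp]
  simp only [dotProduct, Pi.star_apply, dS, Hh, Complex.star_def, dft_HkOp]
  rw [Finset.mul_sum]
  exact Finset.sum_congr rfl fun μ _ => by ring

/-- **THE EULER–LAGRANGE STRUCTURE ON THE FIBRE**: `Ĝ = Δ(p′+l)·Ĥ − ∂(p′+l)·(∂(p′+l)†Ĥ)`, i.e. `Ĝ = (Δ − ∂∂†)Ĥ` (tree: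
`dftV_DstarD_HkOp`, `dft_HkOp`, `dft_divS_HkOp`). [folklore] -/
theorem Gh_eq_proj (B : Tor M × Fin d → ℂ) (k : Fin d → Fin n) (q : Tor M) :
    Gh n M B k q = (star (dS n M k q) ⬝ᵥ dS n M k q) • Hh n M B k q - (star (dS n M k q) ⬝ᵥ Hh n M B k q) • dS n M k q := by
  funext c
  rw [Pi.sub_apply, Pi.smul_apply, Pi.smul_apply, smul_eq_mul, smul_eq_mul, star_dS_dotProduct_dS, star_dS_dotProduct_Hh]
  show (dftV (fine n M) *ᵥ (DstarD n M *ᵥ (HkOp n M *ᵥ B))) (pOf n M (k, q), c) = _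
  rw [dftV_DstarD_HkOp]
  show _ = _ * (dft (fine n M) *ᵥ B5Action121.comp (fine n M) (HkOp n M *ᵥ B) c) (pOf n M (k, q)) - _ * dSym n k (sOf M q) c
  rw [dft_HkOp]
  ring

/-- on the zero fibre `p′ = 0` the Euler–Lagrange vector vanishes. [folklore] -/
theorem Gh_zero (B : Tor M × Fin d → ℂ) (k : Fin d → Fin n) : Gh n M B k 0 = 0 := by
  funext c
  exact dftV_DstarD_HkOp_zero n M B k c

/-- the energy density of the fibre: `e = Ĥ†Ĝ = Δ|Ĥ|² − |∂†Ĥ|²`. [folklore] -/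
theorem energy_density_eq (B : Tor M × Fin d → ℂ) (k : Fin d → Fin n) (q : Tor M) :
    star (Hh n M B k q) ⬝ᵥ Gh n M B k q
      = (star (dS n M k q) ⬝ᵥ dS n M k q) * (star (Hh n M B k q) ⬝ᵥ Hh n M B k q)
        - (star (dS n M k q) ⬝ᵥ Hh n M B k q) * star (star (dS n M k q) ⬝ᵥ Hh n M B k q) := by
  rw [Gh_eq_proj]
  exact form_proj _ _

/-- `|Ĝ|² = Δ(p′+l)·e` (`P² = ΔP`). [folklore] -/
theorem normSq_Gh_eq (B : Tor M × Fin d → ℂ) (k : Fin d → Fin n) (q : Tor M) :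
    star (Gh n M B k q) ⬝ᵥ Gh n M B k q = (star (dS n M k q) ⬝ᵥ dS n M k q) * (star (Hh n M B k q) ⬝ᵥ Gh n M B k q) := by
  rw [energy_density_eq, Gh_eq_proj]
  exact normSq_proj _ _ (star_self_dotProduct _)

/-- `|Ĝ|²` as a real sum of squares. [folklore] -/
theorem star_Gh_dotProduct_Gh (B : Tor M × Fin d → ℂ) (k : Fin d → Fin n) (q : Tor M) :
    star (Gh n M B k q) ⬝ᵥ Gh n M B k q = ((∑ c, ‖Gh n M B k q c‖ ^ 2 : ℝ) : ℂ) := by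
  simp only [dotProduct, Pi.star_apply, Complex.star_def, Complex.conj_mul', Complex.ofReal_sum, Complex.ofReal_pow]

/-- `Δ(p′+l)·e.re = Σ_c|Ĝ_c|²` (real form). [folklore] -/
theorem Delta_mul_density_eq (B : Tor M × Fin d → ℂ) (k : Fin d → Fin n) (q : Tor M) :
    DeltaXir n 0 (shiftr n k (sOf M q)) * (star (Hh n M B k q) ⬝ᵥ Gh n M B k q).re = ∑ c, ‖Gh n M B k q c‖ ^ 2 := by
  have h := normSq_Gh_eq n M B k q
  rw [star_Gh_dotProduct_Gh, star_dS_dotProduct_dS] at h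
  have := congrArg Complex.re h
  rw [Complex.ofReal_re, Complex.re_ofReal_mul] at this
  exact this.symm

/-- **the explicit fibre energy** for `p′ ≠ 0`: `Σ_c|Ĝ_c(p′+l)|² = c⁻²·|u(p′+l)|²·Σ_κ|v_κ(p′+l)|²·|w_κ(p′)|²` (tree
`dftV_DstarD_HkOp_of_ne`, `norm_uSym_sq`, `norm_vSym_sq`). [folklore] -/
theorem sum_normSq_Gh_of_ne (B : Tor M × Fin d → ℂ) (k : Fin d → Fin n) {q : Tor M} (hq : q ≠ 0) :
    ∑ c, ‖Gh n M B k q c‖ ^ 2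
      = ‖((cQ n M : ℂ))⁻¹‖ ^ 2 * (Ur n k (sOf M q) * ∑ c, uFactorr n (k c : ℕ) (sOf M q c)
          * ‖wT n (sOf M q) (fun lam => (dft M *ᵥ B5Action121.comp M B lam) q) c‖ ^ 2) := by
  have hn : 1 ≤ n := Nat.one_le_iff_ne_zero.mpr (NeZero.ne n)
  have hs : ∀ ν, |sOf M q ν| ≤ Real.pi := abs_sOf_le M q
  rw [Finset.mul_sum, Finset.mul_sum]
  refine Finset.sum_congr rfl fun c _ => ?_
  have hG : Gh n M B k q c = ((cQ n M : ℂ))⁻¹ * (conj (uSym n k (sOf M q) * vSym n k (sOf M q) c)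
      * wT n (sOf M q) (fun lam => (dft M *ᵥ B5Action121.comp M B lam) q) c) := dftV_DstarD_HkOp_of_ne n M B k hq c
  rw [hG, norm_mul, norm_mul, mul_pow, mul_pow, Complex.norm_conj, norm_mul, mul_pow,
    norm_uSym_sq n hn k _ hs, norm_vSym_sq n hn k _ c (hs c)]
  ring

end fibre

end Summit.QuantumFields.BalabanUV.T4Continuum.VariationalRegularityFibre
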